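import Literature.Analysis.OperatorTheory.Enflo2023.Vy
import HarnessLib

/-!
# Enflo (2023), arXiv:2305.15442v2 — Lemma 1 set-up, p. 8 l.-2 – p. 9 l.2: `‖ℓ'_{1/2}‖₂ > 0.8` (STEPS row A20)

Source under adjudication: P. Enflo, *On the invariant subspace problem in Hilbert spaces*,
arXiv:2305.15442v2 (6 April 2024).  This module belongs to the repair-cell record of the
CLAIMED proof (Formaliser 1, Part A).  NOTHING here asserts that the paper's argument is correct;
the declarations are kernel-checked versions of inferences the text makes.  Value (BLOCK-2b): typed
inferences about a text — not progress on the invariant subspace problem.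

## WHAT THIS FILE TYPES (v2 pp. 8–9, tex L291–L302)

Set-up of Lemma 1: `T` of Type 1 with distinguished orthonormal `u₀, u₁`,
`x₀ = (√3/2)u₀ + ½u₁` (the text prints `+ u₁`; `½u₁` is what `‖x₀‖ = 1` and p. 7 require — STEPS
row A20 records the typo), `y₀' = (√3/2)u₀`, and `ℓ'_ε` the minimal solution of (1) for `V_{y₀'}`
at radius `ε`.  At `ε = ½`: `‖x₀ − y₀'‖ = ½`, so `e₀` is feasible and `‖ℓ'_{1/2}‖₂ ≤ 1`
(`Vy.norm_minimal_le_one`, already in the tree); the text adds *"since `‖T‖ = 10⁻²⁰`,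
`‖ℓ'_{1/2}‖₂ > 0.8`"*.  This FOLLOWS, with room: the tail `ℓ(T)y₀' − a₀y₀' = T·V_{y₀'}(La)` has
norm `≤ 2‖T‖ ≤ 2·10⁻²⁰` (`Vy.norm_V_sub_head_le`, `‖La‖ ≤ ‖a‖ ≤ 1`), feasibility at radius `½`
then forces `c²|1 − a₀|² + ¼ ≤ (½ + 2·10⁻²⁰)²` for `y₀' = c·u₀`, i.e. `|1 − a₀| ≤ 10⁻⁹` for any
`½ ≤ c ≤ 1` (`Lemma1.setup_coeff_near_one`), hence `‖ℓ'_{1/2}‖₂ ≥ |a₀| > 0.8`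
(`Lemma1.setup_norm_gt`; the paper's `c = √3/2`: `Lemma1.setup_norm_gt_sqrt3`).  Only the upper
bound `≤ 1` is used downstream (row A22, `Lemma1Arith.lean`).

Dictionary: the paper's `⟨u, v⟩` (linear in `u`) is Mathlib's `⟪v, u⟫_ℂ`; `ℓ2 = lp (fun _ : ℕ => ℂ) 2`;
scalars are written as real numbers coerced into `ℂ`.
-/

open scoped InnerProductSpace ENNReal
open Complex

noncomputable section

namespace Literature.Analysis.OperatorTheory.Enflo2023

namespace Lemma1

open Vy

variable {H : Type*} [NormedAddCommGroup H] [InnerProductSpace ℂ H] [CompleteSpace H]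

omit [CompleteSpace H] in
/-- Pythagoras for the frame `u₀ ⟂ u₁` (unit vectors): `‖αu₀ + βu₁‖² = |α|² + |β|²`. [folklore] -/
lemma norm_sq_two_frame (u₀ u₁ : H) (hu₀ : ‖u₀‖ = 1) (hu₁ : ‖u₁‖ = 1) (h01 : ⟪u₀, u₁⟫_ℂ = 0)
    (α β : ℂ) : ‖α • u₀ + β • u₁‖ ^ 2 = ‖α‖ ^ 2 + ‖β‖ ^ 2 := by
  have horth : ⟪α • u₀, β • u₁⟫_ℂ = 0 := by
    rw [inner_smul_left, inner_smul_right, h01, mul_zero, mul_zero]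
  have h := norm_add_sq_eq_norm_sq_add_norm_sq_of_inner_eq_zero _ _ horth
  rw [norm_smul, norm_smul, hu₀, hu₁, mul_one, mul_one] at h
  nlinarith [h]

/-- The tail of the move is tiny: for `‖T‖ ≤ ½`, `‖y‖ ≤ 1` and `‖a‖ ≤ 1`,
`‖V_y a − a₀y‖ ≤ 2‖T‖` (from `Vy.norm_V_sub_head_le`). [cite: Enflo2023, v2 p.9 l.1 ("since ‖T‖ = 10⁻²⁰")] -/
lemma norm_move_tail_le (T : H →L[ℂ] H) (hT : ‖T‖ < 1) (hT2 : ‖T‖ ≤ 1 / 2) (y : H)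
    (hy : ‖y‖ ≤ 1) (a : ℓ2) (ha : ‖a‖ ≤ 1) : ‖V T hT y a - a 0 • y‖ ≤ 2 * ‖T‖ := by
  have h1 := norm_V_sub_head_le T hT y a
  have hL : ‖L a‖ ≤ 1 := (norm_L_apply_le a).trans ha
  have hsq : Real.sqrt (1 / (1 - ‖T‖ ^ 2)) ≤ 2 := by
    rw [Real.sqrt_le_left (by norm_num : (0:ℝ) ≤ 2)]
    rw [div_le_iff₀ (by nlinarith [norm_nonneg T])]
    nlinarith [norm_nonneg T]
  calc ‖V T hT y a - a 0 • y‖ ≤ ‖T‖ * (‖y‖ * Real.sqrt (1 / (1 - ‖T‖ ^ 2))) * ‖L a‖ := h1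
    _ ≤ ‖T‖ * (1 * 2) * 1 := by
        gcongr
    _ = 2 * ‖T‖ := by ring

/-- **Lemma 1 set-up, the head coefficient**: with `y₀' = c·u₀` (`½ ≤ c ≤ 1`), `x₀ = y₀' + ½u₁`,
`u₀ ⟂ u₁` unit vectors, `‖T‖ ≤ 10⁻²⁰`, the minimal solution `a = ℓ'_{1/2}` of (1) at radius `½`
satisfies `|1 − a₀| ≤ 10⁻⁹` (feasibility: `c²|1 − a₀|² + ¼ ≤ (½ + 2‖T‖)²`).
[cite: Enflo2023, v2 p.9 l.1–2 (‖ℓ'_{1/2}‖₂ > 0.8)] -/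
theorem setup_coeff_near_one (T : H →L[ℂ] H) (hT : ‖T‖ < 1) (hT20 : ‖T‖ ≤ (10:ℝ) ^ (-(20:ℤ)))
    (u₀ u₁ : H) (hu₀ : ‖u₀‖ = 1) (hu₁ : ‖u₁‖ = 1) (h01 : ⟪u₀, u₁⟫_ℂ = 0) (c : ℝ) (hc : 1 / 2 ≤ c)
    (hc1 : c ≤ 1) (a : ℓ2)
    (ha : IsMinimal (V T hT ((c : ℂ) • u₀)) ((c : ℂ) • u₀ + ((1 / 2 : ℝ) : ℂ) • u₁) (1 / 2) a) :
    ‖1 - a 0‖ ≤ (10:ℝ) ^ (-(9:ℤ)) := by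
  set y : H := (c : ℂ) • u₀ with hydef
  set x₀ : H := y + ((1 / 2 : ℝ) : ℂ) • u₁ with hx₀def
  have hT20' : ‖T‖ ≤ 1 / 10 ^ 20 := by rwa [zpow_neg, zpow_ofNat, ← one_div] at hT20
  have hc0 : 0 ≤ c := by linarith
  have hy : ‖y‖ ≤ 1 := by
    rw [hydef, norm_smul, Complex.norm_real, Real.norm_of_nonneg hc0, hu₀, mul_one]; exact hc1
  have hxy : ‖x₀ - y‖ ≤ 1 / 2 := by
    rw [hx₀def, add_sub_cancel_left, norm_smul, Complex.norm_real,
      Real.norm_of_nonneg (by norm_num : (0:ℝ) ≤ 1 / 2), hu₁, mul_one]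
  have ha1 : ‖a‖ ≤ 1 := norm_minimal_le_one T hT y x₀ (1 / 2) a ha hxy
  have htail : ‖V T hT y a - a 0 • y‖ ≤ 2 * ‖T‖ :=
    norm_move_tail_le T hT (by linarith) y hy a ha1
  have hfeas : ‖x₀ - V T hT y a‖ ≤ 1 / 2 := ha.1
  -- the head part of `x₀ − ℓ(T)y₀'`
  have hhead : x₀ - a 0 • y = ((1 - a 0) * (c : ℂ)) • u₀ + ((1 / 2 : ℝ) : ℂ) • u₁ := by
    rw [hx₀def, hydef, smul_smul, sub_mul, one_mul, sub_smul]
    abel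
  have hhead_norm : ‖x₀ - a 0 • y‖ ^ 2 = c ^ 2 * ‖1 - a 0‖ ^ 2 + 1 / 4 := by
    rw [hhead, norm_sq_two_frame u₀ u₁ hu₀ hu₁ h01, norm_mul, Complex.norm_real, Real.norm_of_nonneg hc0,
      norm_real, Real.norm_of_nonneg (by norm_num : (0:ℝ) ≤ 1 / 2)]
    ring
  have htri : ‖x₀ - a 0 • y‖ ≤ 1 / 2 + 2 * ‖T‖ := by
    have := norm_sub_le_norm_sub_add_norm_sub x₀ (V T hT y a) (a 0 • y)
    linarith
  -- square and compare
  set d := ‖1 - a 0‖ with hd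
  have hd0 : 0 ≤ d := norm_nonneg _
  have hη0 : 0 ≤ 2 * ‖T‖ := by positivity
  have hsq : c ^ 2 * d ^ 2 + 1 / 4 ≤ (1 / 2 + 2 * ‖T‖) ^ 2 := by
    rw [← hhead_norm]
    exact pow_le_pow_left₀ (norm_nonneg _) htri 2
  have h5 : c ^ 2 * d ^ 2 ≤ 2 * ‖T‖ + (2 * ‖T‖) ^ 2 := by nlinarith [hsq]
  have hc2 : (0:ℝ) ≤ 4 * c ^ 2 - 1 := by nlinarith
  have hd2 : d ^ 2 ≤ 4 * (2 * ‖T‖ + (2 * ‖T‖) ^ 2) := by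
    nlinarith [mul_nonneg hc2 (sq_nonneg d)]
  have hT9 : 4 * (2 * ‖T‖ + (2 * ‖T‖) ^ 2) ≤ ((10:ℝ) ^ (-(9:ℤ))) ^ 2 := by
    rw [zpow_neg, zpow_ofNat]
    nlinarith [norm_nonneg T]
  have habs := abs_le_of_sq_le_sq (hd2.trans hT9) (by positivity)
  rwa [abs_of_nonneg hd0] at habs

/-- **Row A20: `‖ℓ'_{1/2}‖₂ > 0.8`** (indeed `≥ |a₀| ≥ 1 − 10⁻⁹`) in the set-up of Lemma 1, for `y₀' = c·u₀`
with any `½ ≤ c ≤ 1`. [cite: Enflo2023, v2 p.9 l.1–2 (‖ℓ'_{1/2}‖₂ > 0.8)] -/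
theorem setup_norm_gt (T : H →L[ℂ] H) (hT : ‖T‖ < 1) (hT20 : ‖T‖ ≤ (10:ℝ) ^ (-(20:ℤ)))
    (u₀ u₁ : H) (hu₀ : ‖u₀‖ = 1) (hu₁ : ‖u₁‖ = 1) (h01 : ⟪u₀, u₁⟫_ℂ = 0) (c : ℝ) (hc : 1 / 2 ≤ c)
    (hc1 : c ≤ 1) (a : ℓ2)
    (ha : IsMinimal (V T hT ((c : ℂ) • u₀)) ((c : ℂ) • u₀ + ((1 / 2 : ℝ) : ℂ) • u₁) (1 / 2) a) :
    (8 / 10 : ℝ) < ‖a‖ ∧ ‖a‖ ≤ 1 := by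
  have h1 := setup_coeff_near_one T hT hT20 u₀ u₁ hu₀ hu₁ h01 c hc hc1 a ha
  have hxy : ‖((c : ℂ) • u₀ + ((1 / 2 : ℝ) : ℂ) • u₁) - (c : ℂ) • u₀‖ ≤ 1 / 2 := by
    rw [add_sub_cancel_left, norm_smul, Complex.norm_real,
      Real.norm_of_nonneg (by norm_num : (0:ℝ) ≤ 1 / 2), hu₁, mul_one]
  refine ⟨?_, norm_minimal_le_one T hT _ _ (1 / 2) a ha hxy⟩
  have h2 : ‖a 0‖ ≤ ‖a‖ := lp.norm_apply_le_norm (by norm_num) a 0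
  have h3 : 1 - ‖1 - a 0‖ ≤ ‖a 0‖ := by
    have := norm_sub_norm_le (1 : ℂ) (1 - a 0)
    rw [sub_sub_cancel, norm_one] at this
    linarith
  calc (8 / 10 : ℝ) < 1 - (10:ℝ) ^ (-(9:ℤ)) := by rw [zpow_neg, zpow_ofNat]; norm_num
    _ ≤ 1 - ‖1 - a 0‖ := sub_le_sub_left h1 1
    _ ≤ ‖a 0‖ := h3
    _ ≤ ‖a‖ := h2

/-- The paper's data `c = √3/2` (`x₀ = (√3/2)u₀ + ½u₁`, `y₀' = (√3/2)u₀`): `0.8 < ‖ℓ'_{1/2}‖₂ ≤ 1`.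
[cite: Enflo2023, v2 p.9 l.1–2 (‖ℓ'_{1/2}‖₂ > 0.8)] -/
theorem setup_norm_gt_sqrt3 (T : H →L[ℂ] H) (hT : ‖T‖ < 1) (hT20 : ‖T‖ ≤ (10:ℝ) ^ (-(20:ℤ)))
    (u₀ u₁ : H) (hu₀ : ‖u₀‖ = 1) (hu₁ : ‖u₁‖ = 1) (h01 : ⟪u₀, u₁⟫_ℂ = 0) (a : ℓ2)
    (ha : IsMinimal (V T hT (((Real.sqrt 3 / 2 : ℝ) : ℂ) • u₀))
      (((Real.sqrt 3 / 2 : ℝ) : ℂ) • u₀ + ((1 / 2 : ℝ) : ℂ) • u₁) (1 / 2) a) :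
    (8 / 10 : ℝ) < ‖a‖ ∧ ‖a‖ ≤ 1 := by
  have h3 : Real.sqrt 3 ≤ 2 := by
    rw [Real.sqrt_le_left (by norm_num : (0:ℝ) ≤ 2)]; norm_num
  have h1 : 1 ≤ Real.sqrt 3 := by
    rw [Real.le_sqrt (by norm_num : (0:ℝ) ≤ 1) (by norm_num : (0:ℝ) ≤ 3)]; norm_num
  exact setup_norm_gt T hT hT20 u₀ u₁ hu₀ hu₁ h01 (Real.sqrt 3 / 2) (by linarith) (by linarith) a ha

end Lemma1

end Literature.Analysis.OperatorTheory.Enflo2023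

end
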